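import Summits.ValiantsHypothesis.ValiantsHypothesis.Theorems.DivisionGapPerDivisionHardColContent
import Summits.ValiantsHypothesis.ValiantsHypothesis.Theorems.DivisionGapPerDivisionHardStubColContentSubexpRigid
import Summits.ValiantsHypothesis.ValiantsHypothesis.Theorems.DivisionGapPerDivisionHardStubMatrixSplit
import Summits.ValiantsHypothesis.ValiantsHypothesis.Theorems.DivisionGapPerDivisionHardStubTransposePair

/-!
# Crux `DivisionGap.PerDivisionHard` (stmt-ValiantsHypothesis-5065) — the rank rungs, EXTENDED: subexponential
rank, row-ROABPs literally, and the column-cut twin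

Continuation of `Theorems/DivisionGapPerDivisionHardColContent.lean` (the column-content rung: the crux
inequality `2^{(log₂ n + c)^c} < L(per_n · h) + L(h)` for every cofactor `h` whose monomials have few distinct
`A`-column contents `(Σ_{r∈A} m(r,c))_c` on some balanced row set `A` — monotone rank across one balanced row cut).
Three unconditional extensions, compositions of skeleton v13.1 of line `pair-descent-jss-endpoint`
(`Cruxes/PerDivisionHard/Lines/pair_descent_jss_endpoint.lean`) with every stub a landed theorem:

* `perDivisionHard_colContentSubexp` — **the same conclusion already when `|V_A(h)| ≤ 2^{n/(log₂ n+e)^e}`**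
  (`e = e(c)`; rank up to `2^{n/polylog n}` across ONE balanced row cut — within a polylogarithmic factor in the
  exponent of the permanent's own rank `C(n, n/2)` across every balanced row cut), via `stub_colContentSubexpRigid`
  (long subdivision paths `k = n/(16q²)`);
* `perDivisionHard_roabp` — **every nonzero entry of a product `Ms₁.prod * Ms₂.prod` of `W × W` matrices of
  polynomials, `W ≤ 2^{(log₂ n+c)^c}`, the matrices of `Ms₁` in the variables of the rows of `A` and those of `Ms₂`
  in the variables of the other rows** (a monotone row-ROABP of width `W`: any number of layers, any order inside the
  two groups, any degrees), via `stub_matrixSplit` + the row-split rung;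
* `perDivisionHard_rowContent` — **the column-cut twin: few distinct `B`-ROW contents `(Σ_{c∈B} m(r,c))_r` on a
  balanced COLUMN set `B`**, by transposition (`stub_transposePair`: `per_n` is symmetric, renames are free).
-/

noncomputable section

-- `Summit.ValiantsHypothesis.ValiantsHypothesis.…` is the tree's mandated single-conjunct layout
-- (Sub = Summit), so the duplicated namespace component is intended.
set_option linter.dupNamespace false

namespace Summit.ValiantsHypothesis.ValiantsHypothesis.Theorems.DivisionGapPerDivisionHard

open MvPolynomial Literature.Computability.AlgebraicComplexity
open scoped NNReal

/-- **The column-content rung at subexponential rank.**  For every `c` there are `e n₀` such that for all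
`n ≥ n₀`, every nonzero `h ∈ ℝ≥0[x_ij]` and every row set `A` with `n ≤ 4|A| ≤ 3n`: if the monomials of `h` have at
most `2^{n/(log₂ n+e)^e}` distinct `A`-column-content vectors `(Σ_{r∈A} m(r,c))_c`, then
`2^{(log₂ n + c)^c} < L(per_n · h) + L(h)`.  (Torus normal form with sub-support `stub_torusSupport` →
`stub_colContentSubexpRigid` → face descent → JSS contraction → block arsenal.) [folklore] -/
theorem perDivisionHard_colContentSubexp :
    ∀ c : ℕ, ∃ e n₀ : ℕ, ∀ n ≥ n₀, ∀ h : MvPolynomial (Fin n × Fin n) ℝ≥0, h ≠ 0 →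
      ∀ A : Finset (Fin n), n ≤ 4 * A.card → 4 * A.card ≤ 3 * n →
      (h.support.image fun (mm : (Fin n × Fin n) →₀ ℕ) (cc : Fin n) => ∑ r ∈ A, mm (r, cc)).card ≤
          2 ^ (n / (Nat.log 2 n + e) ^ e) →
      2 ^ ((Nat.log 2 n + c) ^ c) <
        complexity (perPoly (Fin n) ℝ≥0 * h) + complexity h := by
  intro c
  obtain ⟨κ, hcon⟩ := stub_jssContraction
  obtain ⟨d, n₁, hhard⟩ := stub_blockArsenal c κ
  obtain ⟨e, n₀, hS⟩ := stub_colContentSubexpRigid d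
  refine ⟨e, n₀ + n₁, ?_⟩
  intro n hn h hh A hA₁ hA₂ hcard
  obtain ⟨h', hh', htor, hsupp, hle1, -⟩ := stub_torusSupport n h hh
  by_contra hlt
  have hle : complexity (perPoly (Fin n) ℝ≥0 * h) + complexity h ≤
      2 ^ ((Nat.log 2 n + c) ^ c) := not_lt.mp hlt
  have hcard' : (h'.support.image fun (mm : (Fin n × Fin n) →₀ ℕ) (cc : Fin n) => ∑ r ∈ A, mm (r, cc)).card ≤
      2 ^ (n / (Nat.log 2 n + e) ^ e) :=
    le_trans (Finset.card_le_card (Finset.image_subset_image hsupp)) hcard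
  obtain ⟨b, k, m, eR, eC, w, u, hb, hcut, hsingle⟩ := hS n (by omega) h' hh' htor A hA₁ hA₂ hcard'
  -- face descent: `x^u · per_G` is (up to one gate) no more expensive than `per · h'`
  have hdesc := stub_faceDescent n (placedBlock eR eC) w h' u hcut hh' hsingle
  have h1 : complexity (monomial u (1 : ℝ≥0) * facePer (placedBlock eR eC)) ≤
      2 ^ ((Nat.log 2 n + c) ^ c) + 1 :=
    calc complexity (monomial u (1 : ℝ≥0) * facePer (placedBlock eR eC))
        ≤ complexity (perPoly (Fin n) ℝ≥0 * h') + 1 := hdesc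
      _ ≤ complexity (perPoly (Fin n) ℝ≥0 * h) + 1 := Nat.add_le_add_right hle1 1
      _ ≤ 2 ^ ((Nat.log 2 n + c) ^ c) + 1 :=
          Nat.add_le_add_right (le_trans (Nat.le_add_right _ _) hle) 1
  -- JSS contraction: strip the monomial at polynomial cost
  have h2 : complexity (facePer (placedBlock eR eC)) ≤
      ((n + 2) * (2 ^ ((Nat.log 2 n + c) ^ c) + 3)) ^ κ :=
    calc complexity (facePer (placedBlock eR eC))
        ≤ ((n + 2) * (complexity (monomial u (1 : ℝ≥0) * facePer (placedBlock eR eC)) + 2)) ^ κ :=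
          hcon n (facePer (placedBlock eR eC)) u
      _ ≤ ((n + 2) * (2 ^ ((Nat.log 2 n + c) ^ c) + 3)) ^ κ :=
          Nat.pow_le_pow_left (Nat.mul_le_mul_left _ (by omega)) κ
  -- the placed block face is harder than that
  have h3 := hhard n (by omega) b k m eR eC hb
  exact absurd (lt_of_lt_of_le h3 h2) (lt_irrefl _)

/-- **The row-ROABP rung.**  For every `c` there is `n₀` such that for all `n ≥ n₀`, every row set `A` with
`n ≤ 4|A| ≤ 3n`, every width `W ≤ 2^{(log₂ n+c)^c}` and all lists `Ms₁, Ms₂` of `W × W` matrices of polynomials,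
the matrices of `Ms₁` in the variables of the rows of `A` and those of `Ms₂` in the variables of the other rows:
every nonzero entry `h = (Ms₁.prod * Ms₂.prod) s₀ t₀` satisfies `2^{(log₂ n+c)^c} < L(per_n·h) + L(h)`.  Such an
entry is a row-split sum `Σ_{s<W} (Ms₁.prod s₀ s) · (Ms₂.prod s t₀)` (`stub_matrixSplit`), so the row-split rung
`perDivisionHard_rowSplit` applies. [folklore] -/
theorem perDivisionHard_roabp :
    ∀ c : ℕ, ∃ n₀ : ℕ, ∀ n ≥ n₀, ∀ (W : ℕ) (A : Finset (Fin n))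
      (Ms₁ Ms₂ : List (Matrix (Fin W) (Fin W) (MvPolynomial (Fin n × Fin n) ℝ≥0))) (s₀ t₀ : Fin W),
      n ≤ 4 * A.card → 4 * A.card ≤ 3 * n → W ≤ 2 ^ ((Nat.log 2 n + c) ^ c) →
      (∀ M ∈ Ms₁, ∀ a b, ∀ mm ∈ (M a b).support, ∀ e ∈ mm.support, e.1 ∈ A) →
      (∀ M ∈ Ms₂, ∀ a b, ∀ mm ∈ (M a b).support, ∀ e ∈ mm.support, e.1 ∉ A) →
      (Ms₁.prod * Ms₂.prod) s₀ t₀ ≠ 0 →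
      2 ^ ((Nat.log 2 n + c) ^ c) <
        complexity (perPoly (Fin n) ℝ≥0 * (Ms₁.prod * Ms₂.prod) s₀ t₀) +
          complexity ((Ms₁.prod * Ms₂.prod) s₀ t₀) := by
  intro c
  obtain ⟨n₀, hR⟩ := perDivisionHard_rowSplit c
  refine ⟨n₀, fun n hn W A Ms₁ Ms₂ s₀ t₀ hA₁ hA₂ hW h₁ h₂ hh => ?_⟩
  obtain ⟨f, g, hfg, hf, hg⟩ := stub_matrixSplit n W A Ms₁ Ms₂ s₀ t₀ h₁ h₂
  rw [hfg] at hh ⊢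
  exact hR n hn W A f g hA₁ hA₂ hW hh hf hg

/-- **The row-content rung (the column-cut twin of `perDivisionHard_colContent`).**  For every `c` there is `n₀`
such that for all `n ≥ n₀`, every nonzero `h` and every COLUMN set `B` with `n ≤ 4|B| ≤ 3n`: if the monomials of
`h` have at most `2^{(log₂ n+c)^c}` distinct `B`-row-content vectors `(Σ_{c∈B} m(r,c))_r`, then
`2^{(log₂ n+c)^c} < L(per_n·h) + L(h)`.  Proof: the column-content rung for the transpose `hᵀ = rename Prod.swap h`
with the row set `B` (`stub_transposePair`: `L(per·hᵀ) ≤ L(per·h)`, `L(hᵀ) ≤ L(h)`, `supp hᵀ = (supp h)ᵀ`); the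
`B`-column contents of `hᵀ` are the `B`-row contents of `h`. [folklore] -/
theorem perDivisionHard_rowContent :
    ∀ c : ℕ, ∃ n₀ : ℕ, ∀ n ≥ n₀, ∀ h : MvPolynomial (Fin n × Fin n) ℝ≥0, h ≠ 0 →
      ∀ B : Finset (Fin n), n ≤ 4 * B.card → 4 * B.card ≤ 3 * n →
      (h.support.image fun (mm : (Fin n × Fin n) →₀ ℕ) (r : Fin n) => ∑ cc ∈ B, mm (r, cc)).card ≤
          2 ^ ((Nat.log 2 n + c) ^ c) →
      2 ^ ((Nat.log 2 n + c) ^ c) <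
        complexity (perPoly (Fin n) ℝ≥0 * h) + complexity h := by
  intro c
  obtain ⟨n₀, hC⟩ := perDivisionHard_colContent c
  refine ⟨n₀, fun n hn h hh B hB₁ hB₂ hcard => ?_⟩
  classical
  set sw : Fin n × Fin n → Fin n × Fin n := Prod.swap with hsw
  have hswinj : Function.Injective sw := Prod.swap_injective
  obtain ⟨hle1, hle2, hsupp⟩ := stub_transposePair n h
  have hh' : rename sw h ≠ 0 := fun h0 => hh (rename_injective sw hswinj (by rw [h0, map_zero]))
  -- the `B`-column contents of `hᵀ` are the `B`-row contents of `h`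
  have hcard' : ((rename sw h).support.image
      fun (mm : (Fin n × Fin n) →₀ ℕ) (cc : Fin n) => ∑ r ∈ B, mm (r, cc)).card ≤ 2 ^ ((Nat.log 2 n + c) ^ c) := by
    rw [hsupp, Finset.image_image]
    refine le_trans (le_of_eq ?_) hcard
    congr 1
    refine Finset.image_congr fun mm _ => ?_
    funext cc
    refine Finset.sum_congr rfl fun r _ => ?_
    change Finsupp.mapDomain sw mm (r, cc) = mm (cc, r)
    rw [show ((r, cc) : Fin n × Fin n) = sw (cc, r) from rfl, Finsupp.mapDomain_apply hswinj]
  have hmain := hC n hn (rename sw h) hh' B hB₁ hB₂ hcard'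
  exact lt_of_lt_of_le hmain (Nat.add_le_add hle1 hle2)

end Summit.ValiantsHypothesis.ValiantsHypothesis.Theorems.DivisionGapPerDivisionHard

end
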